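import Literature.IUT.HodgeTheaters.InitialThetaData
import Literature.NumberTheory.DiophantineGeometry.GenEllFullGalois
import Literature.NumberTheory.EllipticCurves.TorsionCardinality
import HarnessLib

/-!
# Bridge: "the image of `G_F → GL₂(𝔽_l)` contains `SL₂(𝔽_l)`" — [IUTchI] Def. 3.1 (c) typing ↔
# [GenEll] Thm. 3.8 typing

`Proofs` file (theorems only; no definitions, no named facts, no instances) by the cell `abc-iut`
(seat abc-iut-L5-t12; written at the request of abc-iut-L5-t7's (P7)-ARITHMETIC row). Two typings
of the same classical condition live in the tree:

* [IUTchI] Def. 3.1 (c) (S. Mochizuki, *Inter-universal Teichmüller theory I*, kurims May-2020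
  manuscript p. 62: "the image of the outer homomorphism `G_F → GL₂(𝔽_l)` determined by the
  `l`-torsion points of `E_F` contains the subgroup `SL₂(𝔽_l)`"), typed by abc-iut-L5-t2 as
  `Literature.IUT.HodgeTheaters.ImageContainsSL2 Fbar E l` — an `𝔽_l`-basis `(P, Q)` of `E[l](F̄)`
  on which every integer matrix of determinant `≡ 1 (mod l)` is realised by some `σ ∈ Gal(F̄/F)`;
* [GenEll] Thm. 3.8 (Mochizuki 2010, p. 19: "`Im(Gal(Q̄/L) → GL₂(ℤ_l)) ⊇ SL₂(ℤ_l)`"), typed by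
  abc-iut-S4/S-d4 as `GenEll.EllPoint.ImageModLContainsSL2 ⟨F, E⟩ l` — every `𝔽_l`-linear
  endomorphism of determinant `1` of the geometric `l`-torsion `E.geomTorsion l` (Mathlib's
  `AddSubgroup.torsionBy.zmodModule`, `Field.absoluteGaloisGroup F` acting) is a Galois element.

For `l` prime and `F̄ = AlgebraicClosure F` these are EQUIVALENT: the direction the Θ-data
constructor of [IUTchIV] Cor. 2.2 (ii) consumes is `imageContainsSL2_of_imageModLContainsSL2`
(S-chain output (P2)/(P6) ⇒ Def. 3.1 (c) input); the converse (matrix of a linear map in the basis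
`(P, Q)`, lifted to `ℤ`) is `imageModLContainsSL2_of_imageContainsSL2` (appended section).
Linear algebra only: `E[l](F̄)` is an `𝔽_l`-plane (`#E[l] = l²`, tree `card_torsionBy_eq_sq`), so
it has a basis `(c₀, c₁)` (Mathlib `Module.finBasisOfFinrankEq`); an integer matrix `(a b; c d)`
defines the `𝔽_l`-linear map `Matrix.toLin c c !![a, b; c, d]` of determinant `ad − bc`
(`LinearMap.det_toLin`), and conversely a linear map is its matrix in any basis. Nothing of the
series is asserted; no side is taken on [IUTchIII] Cor. 3.12.

## References

* [Mochizuki2012] S. Mochizuki, IUT I, Def. 3.1 (c) p. 62; IUT IV, Cor. 2.2 (ii) p. 46 ((P2), (P6)).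
* [MochizukiGenEll2010] S. Mochizuki, *Arithmetic elliptic curves in general position*, Thm. 3.8.
* [Serre1972] J.-P. Serre, *Propriétés galoisiennes des points d'ordre fini des courbes
  elliptiques*, §4.1 (`φ_l : G → Aut(E_l) ≅ GL₂(𝔽_l)`).
-/

noncomputable section

open scoped Classical

namespace Literature.IUT.HodgeTheaters

open WeierstrassCurve Literature.NumberTheory.DiophantineGeometry
  Literature.NumberTheory.EllipticCurves

section Bridge

variable {F : Type} [Field F] [NumberField F] (E : WeierstrassCurve F) [E.IsElliptic]
  (l : ℕ) [hl : Fact l.Prime]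

/-- `#E[l](F̄) = l²` for the geometric `l`-torsion over `AlgebraicClosure F` (tree
`card_torsionBy_eq_sq`, Silverman *AEC* III.6.4). [cite: SilvermanAEC2009, Cor. III.6.4(b)] -/
theorem natCard_geomTorsion_eq_sq :
    Nat.card (E.geomTorsion (l : ℤ)) = l ^ 2 := by
  haveI : (E.baseChange (AlgebraicClosure F)).IsElliptic :=
    inferInstanceAs (E.map (algebraMap F (AlgebraicClosure F))).IsElliptic
  haveI : CharZero (AlgebraicClosure F) :=
    charZero_of_injective_algebraMap (algebraMap F (AlgebraicClosure F)).injective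
  have hlne : ((l : ℕ) : AlgebraicClosure F) ≠ 0 := by exact_mod_cast hl.out.ne_zero
  exact card_torsionBy_eq_sq (E := E.baseChange (AlgebraicClosure F)) hlne

/-- `E[l](F̄)` is an `𝔽_l`-plane: with Mathlib's `ZMod l`-module structure on the `l`-torsion it
has `finrank = 2` (Serre 1972 §4.1). [cite: Serre1972, §4.1] -/
theorem finrank_geomTorsion_eq_two :
    letI : Module (ZMod l) (E.geomTorsion (l : ℤ)) := AddSubgroup.torsionBy.zmodModule
    Module.finrank (ZMod l) (E.geomTorsion (l : ℤ)) = 2 := by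
  letI : Module (ZMod l) (E.geomTorsion (l : ℤ)) := AddSubgroup.torsionBy.zmodModule
  have hA := natCard_geomTorsion_eq_sq E l
  haveI : Finite (E.geomTorsion (l : ℤ)) :=
    Nat.finite_of_card_ne_zero (by rw [hA]; exact pow_ne_zero _ hl.out.ne_zero)
  haveI : Module.Finite (ZMod l) (E.geomTorsion (l : ℤ)) := Module.Finite.of_finite
  haveI : Module.Free (ZMod l) (E.geomTorsion (l : ℤ)) := Module.Free.of_divisionRing _ _
  have h := Module.natCard_eq_pow_finrank (K := ZMod l) (V := E.geomTorsion (l : ℤ))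
  rw [hA, Nat.card_zmod] at h
  exact (Nat.pow_right_injective hl.out.two_le h).symm

/-- **[GenEll] Thm. 3.8 typing ⟹ [IUTchI] Def. 3.1 (c) typing.** If every determinant-`1`
`𝔽_l`-linear endomorphism of `E[l](F̄)` is a Galois element (`ImageModLContainsSL2`, S-chain), then
an `𝔽_l`-basis `(P, Q)` of `E[l](F̄)` exists on which every integer matrix `(a b; c d)` with
`ad − bc ≡ 1 (mod l)` is realised by some `σ ∈ Gal(F̄/F)` (`ImageContainsSL2`, [IUTchI] Def. 3.1 (c)
as typed), `F̄ = AlgebraicClosure F`, `l` prime. [claim: Mochizuki2012, status: disputed] -/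
theorem imageContainsSL2_of_imageModLContainsSL2 [NeZero l]
    (h : (GenEll.EllPoint.mk F E).ImageModLContainsSL2 l) :
    ImageContainsSL2 (AlgebraicClosure F) E l := by
  letI inst : Module (ZMod l) (E.geomTorsion (l : ℤ)) := AddSubgroup.torsionBy.zmodModule
  -- the hypothesis, with the `EllPoint` projections reduced
  have h' : ∀ f : E.geomTorsion (l : ℤ) →ₗ[ZMod l] E.geomTorsion (l : ℤ), LinearMap.det f = 1 →
      ∃ σ : Field.absoluteGaloisGroup F, ∀ x : E.geomTorsion (l : ℤ), σ • x = f x := h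
  have hrank : Module.finrank (ZMod l) (E.geomTorsion (l : ℤ)) = 2 := finrank_geomTorsion_eq_two E l
  haveI : Finite (E.geomTorsion (l : ℤ)) := Nat.finite_of_card_ne_zero
    (by rw [natCard_geomTorsion_eq_sq E l]; exact pow_ne_zero _ hl.out.ne_zero)
  haveI : Module.Finite (ZMod l) (E.geomTorsion (l : ℤ)) := Module.Finite.of_finite
  let c : Module.Basis (Fin 2) (ZMod l) (E.geomTorsion (l : ℤ)) :=
    Module.finBasisOfFinrankEq (ZMod l) _ hrank
  -- integer scalars act through `ZMod l`; coercions to `E(F̄)`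
  have hz : ∀ (n : ℤ) (x : E.geomTorsion (l : ℤ)), ((n : ZMod l) • x : E.geomTorsion (l : ℤ)) = n • x :=
    fun n x => Int.cast_smul_eq_zsmul (ZMod l) n x
  have hcoe : ∀ (n : ℤ) (x : E.geomTorsion (l : ℤ)),
      ((n • x : E.geomTorsion (l : ℤ)) : geomPoints E) = n • (x : geomPoints E) :=
    fun n x => AddSubgroupClass.coe_zsmul x n
  refine ⟨((c 0 : E.geomTorsion (l : ℤ)) : geomPoints E), ((c 1 : E.geomTorsion (l : ℤ)) : geomPoints E),
    ?_, ?_, ?_, ?_, ?_⟩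
  · exact (Submodule.mem_torsionBy_iff (l : ℤ) ((c 0 : E.geomTorsion (l : ℤ)) : geomPoints E)).mp (c 0).2
  · exact (Submodule.mem_torsionBy_iff (l : ℤ) ((c 1 : E.geomTorsion (l : ℤ)) : geomPoints E)).mp (c 1).2
  · -- independence over `𝔽_l`
    intro a b hab
    have hab' : ((a : ZMod l) • c 0 + (b : ZMod l) • c 1 : E.geomTorsion (l : ℤ)) = 0 := by
      apply Subtype.ext
      rw [hz, hz, AddSubgroup.coe_add, hcoe, hcoe]
      exact hab
    have hrepr := congrArg c.repr hab'
    rw [map_add, map_smul, map_smul, c.repr_self, c.repr_self, map_zero] at hrepr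
    have h0 := congrArg (fun f => f 0) hrepr
    have h1 := congrArg (fun f => f 1) hrepr
    simp only [Finsupp.coe_add, Finsupp.coe_smul, Pi.add_apply, Pi.smul_apply,
      Finsupp.single_eq_same, Finsupp.single_eq_of_ne (show (0 : Fin 2) ≠ 1 by decide),
      Finsupp.single_eq_of_ne (show (1 : Fin 2) ≠ 0 by decide), smul_eq_mul, mul_one, mul_zero,
      add_zero, zero_add, Finsupp.coe_zero, Pi.zero_apply] at h0 h1
    exact ⟨(ZMod.intCast_zmod_eq_zero_iff_dvd a l).mp h0,
      (ZMod.intCast_zmod_eq_zero_iff_dvd b l).mp h1⟩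
  · -- spanning
    intro T hT
    have hTm : (T : geomPoints E) ∈ E.geomTorsion (l : ℤ) :=
      (Submodule.mem_torsionBy_iff (l : ℤ) (T : geomPoints E)).mpr hT
    set x : E.geomTorsion (l : ℤ) := ⟨T, hTm⟩ with hx
    refine ⟨((c.repr x 0).val : ℤ), ((c.repr x 1).val : ℤ), ?_⟩
    have hsum := c.sum_repr x
    rw [Fin.sum_univ_two] at hsum
    have hsum' := congrArg (fun y : E.geomTorsion (l : ℤ) => (y : geomPoints E)) hsum
    simp only [AddSubgroup.coe_add] at hsum'
    have key : ((c.repr x 0).val : ℤ) • ((c 0 : E.geomTorsion (l : ℤ)) : geomPoints E) +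
        ((c.repr x 1).val : ℤ) • ((c 1 : E.geomTorsion (l : ℤ)) : geomPoints E) = (x : geomPoints E) := by
      rw [← hcoe, ← hcoe, ← hz, ← hz]
      simp only [Int.cast_natCast, ZMod.natCast_zmod_val]
      exact hsum'
    exact key.symm
  · -- every determinant-one integer matrix is a Galois element
    intro a b c' d hdet
    let M : Matrix (Fin 2) (Fin 2) (ZMod l) :=
      !![(a : ZMod l), (b : ZMod l); (c' : ZMod l), (d : ZMod l)]
    let f : E.geomTorsion (l : ℤ) →ₗ[ZMod l] E.geomTorsion (l : ℤ) := Matrix.toLin c c M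
    have hfdet : LinearMap.det f = 1 := by
      rw [LinearMap.det_toLin, Matrix.det_fin_two_of]
      have h1 : ((a * d - b * c' - 1 : ℤ) : ZMod l) = 0 :=
        (ZMod.intCast_zmod_eq_zero_iff_dvd _ l).mpr hdet
      push_cast at h1
      linear_combination h1
    obtain ⟨σ, hσ⟩ := h' f hfdet
    have hf0 : f (c 0) = (a : ZMod l) • c 0 + (c' : ZMod l) • c 1 := by
      show Matrix.toLin c c M (c 0) = _
      rw [Matrix.toLin_self, Fin.sum_univ_two]
      rfl
    have hf1 : f (c 1) = (b : ZMod l) • c 0 + (d : ZMod l) • c 1 := by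
      show Matrix.toLin c c M (c 1) = _
      rw [Matrix.toLin_self, Fin.sum_univ_two]
      rfl
    refine ⟨σ, ?_, ?_⟩
    · have e0 := hσ (c 0)
      rw [hf0] at e0
      have e0' := congrArg (fun x : E.geomTorsion (l : ℤ) => (x : geomPoints E)) e0
      simp only [AddSubgroup.coe_add] at e0'
      rw [hz, hz, hcoe, hcoe] at e0'
      exact e0'
    · have e1 := hσ (c 1)
      rw [hf1] at e1
      have e1' := congrArg (fun x : E.geomTorsion (l : ℤ) => (x : geomPoints E)) e1
      simp only [AddSubgroup.coe_add] at e1'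
      rw [hz, hz, hcoe, hcoe] at e1'
      exact e1'

end Bridge

/-! ## The converse: [IUTchI] Def. 3.1 (c) typing ⟹ [GenEll] Thm. 3.8 typing

Appended 2026-08-26 (same seat): with a basis `(P, Q)` as in `ImageContainsSL2`, every
determinant-`1` `𝔽_l`-linear endomorphism `f` of `E[l](F̄)` is the integer matrix
`(toMatrix f)` lifted to `ℤ`, hence a Galois element. -/

section Converse

variable {F : Type} [Field F] [NumberField F] (E : WeierstrassCurve F) [E.IsElliptic]
  (l : ℕ) [hl : Fact l.Prime]

/-- **[IUTchI] Def. 3.1 (c) typing ⟹ [GenEll] Thm. 3.8 typing** (`F̄ = AlgebraicClosure F`, `l`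
prime): if some `𝔽_l`-basis `(P, Q)` of `E[l](F̄)` realises every determinant-one integer matrix by
a Galois element (`ImageContainsSL2`), then every determinant-`1` `𝔽_l`-linear endomorphism of
`E[l](F̄)` is a Galois element (`ImageModLContainsSL2`). With
`imageContainsSL2_of_imageModLContainsSL2` the two typings are equivalent.
[claim: Mochizuki2012, status: disputed] -/
theorem imageModLContainsSL2_of_imageContainsSL2 [NeZero l]
    (h : ImageContainsSL2 (AlgebraicClosure F) E l) :
    (GenEll.EllPoint.mk F E).ImageModLContainsSL2 l := by
  letI inst : Module (ZMod l) (E.geomTorsion (l : ℤ)) := AddSubgroup.torsionBy.zmodModule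
  -- reduce the `EllPoint` projections in the goal
  change ∀ f : E.geomTorsion (l : ℤ) →ₗ[ZMod l] E.geomTorsion (l : ℤ), LinearMap.det f = 1 →
      ∃ σ : Field.absoluteGaloisGroup F, ∀ x : E.geomTorsion (l : ℤ), σ • x = f x
  obtain ⟨P, Q, hP, hQ, hind, hspan, hreal⟩ := h
  have hrank : Module.finrank (ZMod l) (E.geomTorsion (l : ℤ)) = 2 := finrank_geomTorsion_eq_two E l
  haveI : Finite (E.geomTorsion (l : ℤ)) := Nat.finite_of_card_ne_zero
    (by rw [natCard_geomTorsion_eq_sq E l]; exact pow_ne_zero _ hl.out.ne_zero)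
  haveI : Module.Finite (ZMod l) (E.geomTorsion (l : ℤ)) := Module.Finite.of_finite
  have hz : ∀ (n : ℤ) (x : E.geomTorsion (l : ℤ)), ((n : ZMod l) • x : E.geomTorsion (l : ℤ)) = n • x :=
    fun n x => Int.cast_smul_eq_zsmul (ZMod l) n x
  have hcoe : ∀ (n : ℤ) (x : E.geomTorsion (l : ℤ)),
      ((n • x : E.geomTorsion (l : ℤ)) : geomPoints E) = n • (x : geomPoints E) :=
    fun n x => AddSubgroupClass.coe_zsmul x n
  -- the basis `(P, Q)` of the `𝔽_l`-plane
  have hPm : (P : geomPoints E) ∈ E.geomTorsion (l : ℤ) := (Submodule.mem_torsionBy_iff (l : ℤ) _).mpr hP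
  have hQm : (Q : geomPoints E) ∈ E.geomTorsion (l : ℤ) := (Submodule.mem_torsionBy_iff (l : ℤ) _).mpr hQ
  set P' : E.geomTorsion (l : ℤ) := ⟨P, hPm⟩ with hP'
  set Q' : E.geomTorsion (l : ℤ) := ⟨Q, hQm⟩ with hQ'
  have hli : LinearIndependent (ZMod l) ![P', Q'] := by
    rw [LinearIndependent.pair_iff]
    intro s t hst
    have hst' : ((s.val : ℤ) • P + (t.val : ℤ) • Q : geomPoints E) = 0 := by
      have es : (s • P' : E.geomTorsion (l : ℤ)) = ((s.val : ℤ)) • P' := by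
        rw [← hz]; simp only [Int.cast_natCast, ZMod.natCast_zmod_val]
      have et : (t • Q' : E.geomTorsion (l : ℤ)) = ((t.val : ℤ)) • Q' := by
        rw [← hz]; simp only [Int.cast_natCast, ZMod.natCast_zmod_val]
      have := congrArg (fun x : E.geomTorsion (l : ℤ) => (x : geomPoints E)) hst
      simp only [AddSubgroup.coe_add, ZeroMemClass.coe_zero] at this
      rw [es, et, hcoe, hcoe] at this
      exact this
    obtain ⟨hs, ht⟩ := hind _ _ hst'
    constructor
    · have := (ZMod.intCast_zmod_eq_zero_iff_dvd (s.val : ℤ) l).mpr hs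
      simpa only [Int.cast_natCast, ZMod.natCast_zmod_val] using this
    · have := (ZMod.intCast_zmod_eq_zero_iff_dvd (t.val : ℤ) l).mpr ht
      simpa only [Int.cast_natCast, ZMod.natCast_zmod_val] using this
  let b : Module.Basis (Fin 2) (ZMod l) (E.geomTorsion (l : ℤ)) :=
    basisOfLinearIndependentOfCardEqFinrank hli (by rw [Fintype.card_fin, hrank])
  have hb0 : b 0 = P' := by
    rw [coe_basisOfLinearIndependentOfCardEqFinrank]; rfl
  have hb1 : b 1 = Q' := by
    rw [coe_basisOfLinearIndependentOfCardEqFinrank]; rfl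
  intro f hf
  -- the matrix of `f` in the basis `(P, Q)` and its integer lift
  set M := LinearMap.toMatrix b b f with hM
  have hfM : f = Matrix.toLin b b M := (Matrix.toLin_toMatrix b b f).symm
  have hdetM : M.det = 1 := by rw [hM, LinearMap.det_toMatrix]; exact hf
  have hdvd : (l : ℤ) ∣ ((M 0 0).val : ℤ) * ((M 1 1).val : ℤ) - ((M 0 1).val : ℤ) * ((M 1 0).val : ℤ) - 1 := by
    rw [← ZMod.intCast_zmod_eq_zero_iff_dvd]
    push_cast
    simp only [ZMod.natCast_zmod_val]
    rw [Matrix.det_fin_two] at hdetM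
    linear_combination hdetM
  obtain ⟨σ, hσP, hσQ⟩ := hreal _ _ _ _ hdvd
  let σ' : Field.absoluteGaloisGroup F := σ
  -- `f` on the basis
  have hfP : f P' = ((M 0 0).val : ℤ) • P' + ((M 1 0).val : ℤ) • Q' := by
    rw [← hz, ← hz]
    simp only [Int.cast_natCast, ZMod.natCast_zmod_val]
    rw [hfM, ← hb0, Matrix.toLin_self, Fin.sum_univ_two, hb0, hb1]
  have hfQ : f Q' = ((M 0 1).val : ℤ) • P' + ((M 1 1).val : ℤ) • Q' := by
    rw [← hz, ← hz]
    simp only [Int.cast_natCast, ZMod.natCast_zmod_val]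
    rw [hfM, ← hb1, Matrix.toLin_self, Fin.sum_univ_two, hb0, hb1]
  -- `σ` agrees with `f` on `P`, `Q` …
  have hσP' : σ' • P' = f P' := by
    apply Subtype.ext
    rw [hfP, AddSubgroup.coe_add, hcoe, hcoe]
    exact hσP
  have hσQ' : σ' • Q' = f Q' := by
    apply Subtype.ext
    rw [hfQ, AddSubgroup.coe_add, hcoe, hcoe]
    exact hσQ
  -- … hence everywhere (both are additive, and `P, Q` span over `ℤ`)
  refine ⟨σ', fun x => ?_⟩
  have hx := b.sum_repr x
  rw [Fin.sum_univ_two, hb0, hb1] at hx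
  have e0 : ((b.repr x 0) • P' : E.geomTorsion (l : ℤ)) = ((b.repr x 0).val : ℤ) • P' := by
    rw [← hz]; simp only [Int.cast_natCast, ZMod.natCast_zmod_val]
  have e1 : ((b.repr x 1) • Q' : E.geomTorsion (l : ℤ)) = ((b.repr x 1).val : ℤ) • Q' := by
    rw [← hz]; simp only [Int.cast_natCast, ZMod.natCast_zmod_val]
  rw [← hx, e0, e1, smul_add, map_add, map_zsmul, map_zsmul,
    smul_comm σ' ((b.repr x 0).val : ℤ) P', smul_comm σ' ((b.repr x 1).val : ℤ) Q', hσP', hσQ']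

end Converse

end Literature.IUT.HodgeTheaters
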